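import Summits.QuantumFields.BalabanUV.T4Continuum.Support.CoordSlabPoincareHi

/-!
# `BalabanUV.T4Continuum.Support.CoordOctantBoxes` — NE2 (node U1a) formalisation swarm, sub-row `T4-U1a.S-NE2-D1-DIRICHLET°`,
# supplier item «Δ1-HOLEFILL» (brick H-B, part 3a of 3): THE VANISHING OCTANT OF THE COORDINATE CUBE `Fin d → Fin 4k`, its auxiliary
# boxes and their cardinalities, and the whole-cube Poincaré inequality with a vanishing octant
# (unit b2b-balaban-t4-ne2-formalise-leaf-08, gen 6, file 3a — split off file 3 for the 400-line rule)

HONEST FRAMING.  Rung (B)+1 bookkeeping at MODEL level; [folklore] finite lattice calculus; NE2 (U1a) is NOT proved by this file; spine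
PROVED 0/9 unchanged; NOT infinite volume, NOT the mass gap, NOT Clay.  HONEST DEPENDENCY (verbatim): «continuum YM on T⁴ ⇐ BetaPertH ∧ nine
spine estimates (0/9 proved); BetaPertH ⇐ (D1) ∧ (D4) ∧ CAP+tail; G-an2-4 gates asym, D1 and NE2/3/4.»

WHAT THIS FILE PROVES (0 sorry).  On the coordinate cube `Fin d → Fin (n+1)` with `4k = n + 1`, for a sign pattern `σ : Fin d → Bool`
(the OCTANT `oct σ k = {y : ∀ λ, 2k ≤ y λ ↔ σ λ}` on which the field vanishes — in the application: the exterior unit block at a boundary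
vertex of the region):
 * §1 one-dimensional quarters ∕ halves and their cardinalities (`k`, `2k`), the boxes `octT` (the `σ`-side quarter-slab inside the octant,
   `k·(2k)^{d−1}` points) and `octW` (the overlap of a far slab with an orthogonal `σ`-side slab, `k²·(4k)^{d−2}` points, `d ≥ 2`);
 * §2 **`sum_norm_sq_cube_le`**: `F = 0` on `oct σ k` ⇒ `Σ_y ‖F y‖² ≤ (1 + 2^d)·(n(n+1)/2)·dirOn univ F` (the source-term Poincaré of the
   hole-filling step; `FiniteVarianceGluing.sum_norm_sq_le_of_vanish` + `CoordSlabPoincare.cvar_univ_le`, `|J|/|oct| = 2^d`).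
 The annulus inequality itself is file 3b (`CoordAnnulusPoincare`).

ABSOLUTE RULE (cell, verbatim): «No internally-minted statement may enter as a cited fact. Every hypothesis is either kernel-proved in
this package or a verbatim quotation of a PUBLISHED theorem with page reference. The manuscript(s) under audit are NOT citable for
their own disputed steps — they are the thing under adjudication; programme-internal (2001/route/tribunal) claims are never citable.»
[folklore]; plain data `def`s, no `def … : Prop` fact; constants explicit and generous (no attempt at optimality).  NOT CLAIMED: anything
analytic; NE2.
-/

noncomputable section

open scoped BigOperators ComplexConjugate
open Finset

namespace Summit.QuantumFields.BalabanUV.T4Continuum.CoordOctantBoxes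

open Literature.MathematicalPhysics.QuantumFieldTheory.Balaban1983to89.Beta.CoordCubePoincare (stepUp)
open Summit.QuantumFields.BalabanUV.T4Continuum.FiniteVarianceGluing (cvar cvar_nonneg sum_norm_sq_le_of_vanish sum_norm_sq_le_of_gluing)
open Summit.QuantumFields.BalabanUV.T4Continuum.CoordSlabPoincare
open Summit.QuantumFields.BalabanUV.T4Continuum.CoordSlabPoincareHi (hi mem_hi cvar_hi_le)

variable {n d : ℕ}

/-! ## §1 Quarters, halves, the octant and the two auxiliary boxes -/

section Boxes

variable (k : ℕ)

/-- the low quarter `{i < k}` of `Fin (n+1)`. [folklore] -/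
def qLo : Finset (Fin (n + 1)) := univ.filter (fun i : Fin (n + 1) => (i : ℕ) < k)
/-- the high quarter `{i ≥ n + 1 − k}`. [folklore] -/
def qHi : Finset (Fin (n + 1)) := univ.filter (fun i : Fin (n + 1) => n + 1 ≤ (i : ℕ) + k)
/-- the low half `{i < 2k}`. [folklore] -/
def hLo : Finset (Fin (n + 1)) := univ.filter (fun i : Fin (n + 1) => (i : ℕ) < 2 * k)
/-- the high half `{2k ≤ i}`. [folklore] -/
def hHi : Finset (Fin (n + 1)) := univ.filter (fun i : Fin (n + 1) => 2 * k ≤ (i : ℕ))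

/-- `|qLo| = k` (for `4k = n + 1`). [folklore] -/
theorem card_qLo (hk : 4 * k = n + 1) : (qLo (n := n) k).card = k := by
  have h : qLo (n := n) k = Finset.Iio (⟨k, by omega⟩ : Fin (n + 1)) := by
    ext i; simp [qLo, Finset.mem_Iio, Fin.lt_def]
  rw [h, Fin.card_Iio]

/-- `|qHi| = k`. [folklore] -/
theorem card_qHi (hk : 4 * k = n + 1) : (qHi (n := n) k).card = k := by
  have h : qHi (n := n) k = Finset.Ici (⟨n + 1 - k, by omega⟩ : Fin (n + 1)) := by
    ext i; simp [qHi, Finset.mem_Ici, Fin.le_def]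
  rw [h, Fin.card_Ici]; dsimp only; omega

/-- `|hLo| = 2k`. [folklore] -/
theorem card_hLo (hk : 4 * k = n + 1) : (hLo (n := n) k).card = 2 * k := by
  have h : hLo (n := n) k = Finset.Iio (⟨2 * k, by omega⟩ : Fin (n + 1)) := by
    ext i; simp [hLo, Finset.mem_Iio, Fin.lt_def]
  rw [h, Fin.card_Iio]

/-- `|hHi| = 2k`. [folklore] -/
theorem card_hHi (hk : 4 * k = n + 1) : (hHi (n := n) k).card = 2 * k := by
  have h : hHi (n := n) k = Finset.Ici (⟨2 * k, by omega⟩ : Fin (n + 1)) := by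
    ext i; simp [hHi, Finset.mem_Ici, Fin.le_def]
  rw [h, Fin.card_Ici]; dsimp only; omega

/-- the `σ`-side quarter. [folklore] -/
def xq (b : Bool) : Finset (Fin (n + 1)) := if b then qHi (n := n) k else qLo (n := n) k
/-- the far quarter. [folklore] -/
def fq (b : Bool) : Finset (Fin (n + 1)) := if b then qLo (n := n) k else qHi (n := n) k
/-- the `σ`-side half. [folklore] -/
def half (b : Bool) : Finset (Fin (n + 1)) := if b then hHi (n := n) k else hLo (n := n) k

/-- `|xq| = k`. [folklore] -/
theorem card_xq (hk : 4 * k = n + 1) (b : Bool) : (xq (n := n) k b).card = k := by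
  cases b <;> simp [xq, card_qLo k hk, card_qHi k hk]

/-- `|fq| = k`. [folklore] -/
theorem card_fq (hk : 4 * k = n + 1) (b : Bool) : (fq (n := n) k b).card = k := by
  cases b <;> simp [fq, card_qLo k hk, card_qHi k hk]

/-- `|half| = 2k`. [folklore] -/
theorem card_half (hk : 4 * k = n + 1) (b : Bool) : (half (n := n) k b).card = 2 * k := by
  cases b <;> simp [half, card_hLo k hk, card_hHi k hk]

variable (σ : Fin d → Bool)

/-- the OCTANT `oct σ k = Π_λ half (σ λ)` (on which the field vanishes). [folklore] -/
def oct : Finset (Fin d → Fin (n + 1)) := Fintype.piFinset (fun lam => half (n := n) k (σ lam))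

/-- membership in the octant, digitwise. [folklore] -/
theorem mem_oct {y : Fin d → Fin (n + 1)} : y ∈ oct (n := n) k σ ↔ ∀ lam, (2 * k ≤ (y lam : ℕ) ↔ σ lam = true) := by
  rw [oct, Fintype.mem_piFinset]
  refine forall_congr' fun lam => ?_
  cases σ lam <;> simp [half, hHi, hLo]

/-- `|oct| = (2k)^d`. [folklore] -/
theorem card_oct (hk : 4 * k = n + 1) : (oct (n := n) k σ).card = (2 * k) ^ d := by
  rw [oct, Fintype.card_piFinset]
  simp_rw [card_half k hk]
  rw [Finset.prod_const, Finset.card_univ, Fintype.card_fin]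

/-- the box `octT μ` = (σ-side quarter in direction `μ`) × (σ-side halves elsewhere): inside the σ-side slab AND inside the octant. [folklore] -/
def octT (μ : Fin d) : Finset (Fin d → Fin (n + 1)) :=
  Fintype.piFinset (fun lam => if lam = μ then xq (n := n) k (σ μ) else half (n := n) k (σ lam))

/-- `|octT μ| = k·(2k)^{d−1}` (stated multiplicatively). [folklore] -/
theorem card_octT (hk : 4 * k = n + 1) (μ : Fin d) : (octT (n := n) k σ μ).card * 2 = (2 * k) ^ d := by
  rw [octT, Fintype.card_piFinset, ← Finset.mul_prod_erase univ _ (mem_univ μ)]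
  simp only [if_true]
  rw [Finset.prod_congr rfl (fun lam hlam => by rw [if_neg (Finset.ne_of_mem_erase hlam)]), card_xq k hk]
  simp_rw [card_half k hk]
  rw [Finset.prod_const, Finset.card_erase_of_mem (mem_univ μ), Finset.card_univ, Fintype.card_fin]
  obtain ⟨e, rfl⟩ : ∃ e, d = e + 1 := ⟨d - 1, (Nat.succ_pred_eq_of_pos (Fin.pos μ)).symm⟩
  rw [Nat.add_sub_cancel, pow_succ]; ring

/-- the box `octW μ ν` = (far quarter in direction `μ`) × (σ-side quarter in direction `ν`) × (everything elsewhere). [folklore] -/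
def octW (μ ν : Fin d) : Finset (Fin d → Fin (n + 1)) :=
  Fintype.piFinset (fun lam => if lam = μ then fq (n := n) k (σ μ) else if lam = ν then xq (n := n) k (σ ν) else univ)

/-- `|octW μ ν|·16 = (4k)^d = (n+1)^d` for `μ ≠ ν`. [folklore] -/
theorem card_octW (hk : 4 * k = n + 1) {μ ν : Fin d} (hμν : μ ≠ ν) : (octW (n := n) k σ μ ν).card * 16 = (n + 1) ^ d := by
  rw [octW, Fintype.card_piFinset, ← Finset.mul_prod_erase univ _ (mem_univ μ)]
  simp only [if_true]
  rw [Finset.prod_congr rfl (fun lam hlam => by rw [if_neg (Finset.ne_of_mem_erase hlam)]), card_fq k hk,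
    ← Finset.mul_prod_erase (univ.erase μ) _ (Finset.mem_erase.mpr ⟨Ne.symm hμν, mem_univ ν⟩)]
  simp only [if_true]
  rw [Finset.prod_congr rfl (fun lam hlam => by rw [if_neg (Finset.ne_of_mem_erase hlam)]), card_xq k hk]
  simp only [Finset.card_univ, Fintype.card_fin, Finset.prod_const]
  rw [Finset.card_erase_of_mem (Finset.mem_erase.mpr ⟨Ne.symm hμν, mem_univ ν⟩), Finset.card_erase_of_mem (mem_univ μ),
    Finset.card_univ, Fintype.card_fin]
  have hd : 2 ≤ d := by
    by_contra h
    have : d ≤ 1 := by omega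
    exact hμν (Fin.ext (by have := μ.isLt; have := ν.isLt; omega))
  obtain ⟨e, rfl⟩ : ∃ e, d = e + 2 := ⟨d - 2, by omega⟩
  rw [show e + 2 - 1 - 1 = e by omega, ← hk, pow_add]; ring

/-- `octT μ ⊆ oct`. [folklore] -/
theorem octT_subset_oct (hk : 4 * k = n + 1) (μ : Fin d) : octT (n := n) k σ μ ⊆ oct (n := n) k σ := by
  intro y hy
  rw [octT, Fintype.mem_piFinset] at hy
  rw [oct, Fintype.mem_piFinset]
  intro lam
  have h := hy lam
  by_cases hl : lam = μ
  · subst hl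
    rw [if_pos rfl] at h
    revert h
    cases σ lam <;> simp [xq, half, qHi, qLo, hHi, hLo] <;> omega
  · rw [if_neg hl] at h; exact h

end Boxes

/-! ## §2 The whole cube with a vanishing octant -/

/-- `|J| = (n+1)^d`. [folklore] -/
theorem card_cube : Fintype.card (Fin d → Fin (n + 1)) = (n + 1) ^ d := by
  rw [Fintype.card_fun, Fintype.card_fin, Fintype.card_fin]

/-- `(n+1)^d = 2^d·(2k)^d` for `4k = n + 1` (real form). [folklore] -/
theorem pow_cube_eq {k : ℕ} (hk : 4 * k = n + 1) : ((n : ℝ) + 1) ^ d = 2 ^ d * (2 * (k : ℝ)) ^ d := by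
  rw [← mul_pow]
  congr 1
  have : ((4 * k : ℕ) : ℝ) = ((n + 1 : ℕ) : ℝ) := by rw [hk]
  push_cast at this
  linarith

/-- **THE CUBE WITH A VANISHING OCTANT**: `F = 0` on `oct σ k` ⇒ `Σ_y ‖F y‖² ≤ (1 + 2^d)·(n(n+1)/2)·dirOn univ F`. [folklore] -/
theorem sum_norm_sq_cube_le {k : ℕ} (hk : 4 * k = n + 1) (σ : Fin d → Bool) (F : (Fin d → Fin (n + 1)) → ℂ)
    (hF : ∀ y ∈ oct (n := n) k σ, F y = 0) :
    ∑ y, ‖F y‖ ^ 2 ≤ (1 + 2 ^ d) * ((n : ℝ) * (n + 1) / 2) * dirOn univ F := by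
  have hkpos : 0 < k := by omega
  have hTn : (oct (n := n) k σ).Nonempty := by
    rw [← Finset.card_pos, card_oct k σ hk]; positivity
  have h1 := sum_norm_sq_le_of_vanish (Finset.subset_univ _) hTn hF
  have hratio : ((univ : Finset (Fin d → Fin (n + 1))).card : ℝ) / (oct (n := n) k σ).card = 2 ^ d := by
    rw [Finset.card_univ, card_cube, card_oct k σ hk]
    push_cast
    rw [pow_cube_eq hk, mul_div_assoc, div_self (by positivity), mul_one]
  rw [hratio] at h1
  have h2 := cvar_univ_le F
  have hP : (0 : ℝ) ≤ 1 + 2 ^ d := by positivity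
  calc ∑ y, ‖F y‖ ^ 2 ≤ (1 + 2 ^ d) * cvar univ F := h1
    _ ≤ (1 + 2 ^ d) * ((n : ℝ) * (n + 1) / 2 * dirOn univ F) := mul_le_mul_of_nonneg_left h2 hP
    _ = _ := by ring

end Summit.QuantumFields.BalabanUV.T4Continuum.CoordOctantBoxes

end
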